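import Summits.HodgeConjecture.HodgeConjecture.Theorems.H413E2SWBorelBoundFrame
import HarnessLib

/-!
# Crux H413, E-2 child line `F0_E2SiegelWeilWeilRange`, I-CLOSE row (hLD-grp): THE TORUS GROUP LETTER —
# every Levi element `d(t) = M·diag(t, (c̄t)⁻¹)·M⁻¹` of `U_D` has a lift `q` over `j d(t)` acting by the PURE TWIST `twistLM Mt`

HC_CM is proved only modulo the printed citations until rung 0 closes; nothing in this file is about HC.  Cell `hodgecm-mathlib`,
floor 0, programme P4, engine E-2, item stmt-HodgeConjecture-24833 (`--supports`); seat A-p16 (g18); F0P4-plan (g4) row (hLD-grp)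
2026-08-31T04:59:18Z (consumer: (S-1) `Theorems/H413E2SWDilateBoundCM`, p05 (g2)).

THE OBJECTS are those of ★ `H413E2SWBorelBoundFrame` (p07 (g3)), binders VERBATIM: the frame element `u₀` (`hu₀`), the `W`-side
sum-model hom `jS` (`hjS`, ★ `UnitaryGroup.exists_sumModelHom`), the hom of record `j = conj(π u₀ · π(doublingDeltaLift)) ∘ spReindex ∘ jS`
(`hj`), the Cayley matrix `M` (`hM`, ★ `exists_cayleyTwo`).  For a torus element `t ∈ 𝔸_E^×` write `U = t⁻¹ = p₁ + q₁δ` and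
`V = c̄t = p₂ + q₂δ` (the scalars of `d(t)⁻¹ = d(t⁻¹, c̄t)` on `W^Δ`, `W^∇`); then `U · c̄V = 1` gives `p₁p₂ − d q₁q₂ = 1`, `p₁q₂ = q₁p₂`.

THE THEOREM `exists_lift_torus` — the torus twin of the real-ray branch of ★ `exists_borelBound_frame` (same road, token for token):
`g := jS d(t) ∈ Stab(W^Δ)` (both `g`, `g⁻¹ = jS d(t⁻¹)` keep diagonal vectors diagonal: ★ `toSp_adelicInr_cayley_conj_glDiagonal_apply`
through `hjS`), `q := u₀ · 𝐫₀ᶜᵒⁿᵗ(P_g) · u₀⁻¹`, `P_g = δ̃ g δ̃⁻¹` (★ `stabDiagParabolicFin`), `proj q = j d(t)` (★ `proj_frameLift_eq`), and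
`ω q = twistLM Mt` for ANY GL-element `Mt` with matrix `reindex (p₂•1 | q₂•𝕋 ; (d q₂)•𝕋⁻¹ | p₂•1)` (★ A-p12 (J-D)
`omega_conj_adelicSiegelLiftCont_of_torusShape`).  The modulus `L q` and the construction of `Mt` are not in this file.

References: A. Weil, *Sur certains groupes d'opérateurs unitaires*, Acta Math. 111 (1964), Chap. I n° 13 p. 160 (`d₀(α)`) [Weil1964];
A. Weil, *Sur la formule de Siegel…*, Acta Math. 113 (1965), n° 46 p. 66, n° 47 Lemme 20 [Weil1965]; J.-S. Li, J. reine angew. Math. 428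
(1992), p. 181 [Li1992].
-/

set_option autoImplicit false

noncomputable section

set_option linter.dupNamespace false

namespace Summit.HodgeConjecture.HodgeConjecture.Cruxes.H413.E2SWBorelBoundTorus

open scoped NNReal ENNReal Matrix
open _root_.MeasureTheory NumberField IsDedekindDomain Matrix
open Literature.RepresentationTheory.HeisenbergGroup
open Literature.NumberTheory.Weil1964 Literature.NumberTheory.Weil1965 Literature.NumberTheory.Automorphic
open Literature.NumberTheory.Automorphic.DoubledUnitary.RankOneReduction
open Literature.NumberTheory.Automorphic.UnitaryGroup
open Literature.NumberTheory.Automorphic.UnitaryGroup.QuadraticCoordinates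
open Literature.NumberTheory.GelbartRogawski1991 Literature.NumberTheory.GelbartRogawski1991.UnitaryDualPair
open Summit.HodgeConjecture.HodgeConjecture.Cruxes.H413.E2SWBorelBoundFrame

variable (F E : Type) [Field F] [NumberField F] [Field E] [NumberField E] [Algebra F E] [Algebra.IsQuadraticExtension F E]
  (c : E ≃ₐ[F] E) {δ : E} (hcδ : c δ = -δ) (hδ : δ ≠ 0) {d : F} (hd : δ * δ = algebraMap F E d)
  (N : ℕ) {n : ℕ} (e : Fin N × Fin 1 ≃ Fin n)
  {TV : Matrix (Fin N) (Fin N) F} (TW : Matrix (Fin 1) (Fin 1) F) (hV : TV.IsSymm)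
  (hW2 : (Matrix.reindex finSumFinEquiv finSumFinEquiv (Matrix.fromBlocks TW 0 0 (-TW))).IsSymm)
  (hVd : IsUnit TV.det) (hWd : IsUnit TW.det)

omit [NumberField F] [Algebra.IsQuadraticExtension F E] in
/-- `d(t)⁻¹ = d(t⁻¹)` for the Levi element `d(t) = M·diag(t, (c̄t)⁻¹)·M⁻¹` (the torus is a one-parameter group). [cite: Weil1965, n° 47 Lemme 20 (p. 67)] -/
theorem cayley_conj_diag_inv (M : GL (Fin 2) (AdeleRing (𝓞 E) E)) (t : (AdeleRing (𝓞 E) E)ˣ) :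
    (M * glDiagonal 2 (AdeleRing (𝓞 E) E)
        ![t, (Units.map (UnitaryGroup.conjAdele F E c : AdeleRing (𝓞 E) E →* AdeleRing (𝓞 E) E) t)⁻¹] * M⁻¹)⁻¹ =
      M * glDiagonal 2 (AdeleRing (𝓞 E) E)
        ![t⁻¹, (Units.map (UnitaryGroup.conjAdele F E c : AdeleRing (𝓞 E) E →* AdeleRing (𝓞 E) E) t⁻¹)⁻¹] * M⁻¹ := by
  have hvec : (![t, (Units.map (UnitaryGroup.conjAdele F E c : AdeleRing (𝓞 E) E →* AdeleRing (𝓞 E) E) t)⁻¹] :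
      Fin 2 → (AdeleRing (𝓞 E) E)ˣ)⁻¹ =
      ![t⁻¹, (Units.map (UnitaryGroup.conjAdele F E c : AdeleRing (𝓞 E) E →* AdeleRing (𝓞 E) E) t⁻¹)⁻¹] := by
    funext i
    fin_cases i
    · rfl
    · simp [map_inv]
  rw [_root_.mul_inv_rev, _root_.mul_inv_rev, inv_inv, ← map_inv, hvec, mul_assoc]

/-- **The sum-model action of a Levi element** `d(u,w) = M·diag(u,w)·M⁻¹ ∈ U_D` through `jS`: the `E`-scalar `u = p₁ + q₁δ` on `W^Δ`,
`w = p₂ + q₂δ` on `W^∇` (★ A-p16 `toSp_adelicInr_cayley_conj_glDiagonal_apply` read through `hjS` and `reindexW`).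
[cite: Weil1965, n° 47 Lemme 20 (p. 67)] -/
theorem sumModel_apply_sumElim_levi (hTW : TW 0 0 ≠ 0)
    (jS : ↥(UnitaryGroup.adelic F E c (1 + 1)
        ((Matrix.reindex finSumFinEquiv finSumFinEquiv (Matrix.fromBlocks TW 0 0 (-TW))).map (algebraMap F E))) →*
      ↥(symplecticGroup (polar (Matrix.toLinearMap₂' (AdeleRing (𝓞 F) F)
        (Matrix.fromBlocks (adelicGram F e TV TW) 0 0 (-adelicGram F e TV TW))))))
    (hjS : ∀ (A : ↥(UnitaryGroup.adelic F E c (1 + 1)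
        ((Matrix.reindex finSumFinEquiv finSumFinEquiv (Matrix.fromBlocks TW 0 0 (-TW))).map (algebraMap F E))))
        (v : (Fin (n + n) → AdeleRing (𝓞 F) F) × (Fin (n + n) → AdeleRing (𝓞 F) F)),
      ((spReindex (finSumFinEquiv : Fin n ⊕ Fin n ≃ Fin (n + n))
          (Matrix.fromBlocks (adelicGram F e TV TW) 0 0 (-adelicGram F e TV TW)) (jS A) :
          symplecticGroup (polar (Matrix.toLinearMap₂' (AdeleRing (𝓞 F) F)
            (Matrix.reindex finSumFinEquiv finSumFinEquiv
              (Matrix.fromBlocks (adelicGram F e TV TW) 0 0 (-adelicGram F e TV TW)))))) :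
        ((Fin (n + n) → AdeleRing (𝓞 F) F) × (Fin (n + n) → AdeleRing (𝓞 F) F)) ≃ₗ[AdeleRing (𝓞 F) F]
          ((Fin (n + n) → AdeleRing (𝓞 F) F) × (Fin (n + n) → AdeleRing (𝓞 F) F))) v =
      ((toSp F E c N (1 + 1)
          (((Equiv.prodCongr (Equiv.refl (Fin N)) finSumFinEquiv.symm).trans (Equiv.prodSumDistrib (Fin N) (Fin 1) (Fin 1))).trans
            ((Equiv.sumCongr e e).trans finSumFinEquiv))
          (TV.map (algebraMap F E)) ((Matrix.reindex finSumFinEquiv finSumFinEquiv (Matrix.fromBlocks TW 0 0 (-TW))).map (algebraMap F E))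
          hcδ hδ hd hV hW2 rfl rfl
          (adelicInr F E c N (1 + 1) (TV.map (algebraMap F E))
            ((Matrix.reindex finSumFinEquiv finSumFinEquiv (Matrix.fromBlocks TW 0 0 (-TW))).map (algebraMap F E)) A) :
          symplecticGroup (polar (adelicForm F (Fin (n + n))
            (adelicGram F
              (((Equiv.prodCongr (Equiv.refl (Fin N)) finSumFinEquiv.symm).trans (Equiv.prodSumDistrib (Fin N) (Fin 1) (Fin 1))).trans
                ((Equiv.sumCongr e e).trans finSumFinEquiv)) TV
              (Matrix.reindex finSumFinEquiv finSumFinEquiv (Matrix.fromBlocks TW 0 0 (-TW))))))) :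
        ((Fin (n + n) → AdeleRing (𝓞 F) F) × (Fin (n + n) → AdeleRing (𝓞 F) F)) ≃ₗ[AdeleRing (𝓞 F) F]
          ((Fin (n + n) → AdeleRing (𝓞 F) F) × (Fin (n + n) → AdeleRing (𝓞 F) F))) v)
    {M : GL (Fin 2) (AdeleRing (𝓞 E) E)}
    (hM : (M : Matrix (Fin 2) (Fin 2) (AdeleRing (𝓞 E) E)) =
      !![1, algebraMap E (AdeleRing (𝓞 E) E) (algebraMap F E (2 * TW 0 0)⁻¹);
        1, -algebraMap E (AdeleRing (𝓞 E) E) (algebraMap F E (2 * TW 0 0)⁻¹)])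
    (u w : (AdeleRing (𝓞 E) E)ˣ)
    (hA : M * glDiagonal 2 (AdeleRing (𝓞 E) E) ![u, w] * M⁻¹ ∈
      UnitaryGroup.adelic F E c (1 + 1) ((Matrix.reindex finSumFinEquiv finSumFinEquiv (Matrix.fromBlocks TW 0 0 (-TW))).map (algebraMap F E)))
    (p₁ q₁ p₂ q₂ : AdeleRing (𝓞 F) F)
    (hp₁ : QuadraticCoordinates.re (quadraticAdeleEquiv F E c hcδ hδ).toAddEquiv (u : AdeleRing (𝓞 E) E) = p₁)
    (hq₁ : QuadraticCoordinates.im (quadraticAdeleEquiv F E c hcδ hδ).toAddEquiv (u : AdeleRing (𝓞 E) E) = q₁)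
    (hp₂ : QuadraticCoordinates.re (quadraticAdeleEquiv F E c hcδ hδ).toAddEquiv (w : AdeleRing (𝓞 E) E) = p₂)
    (hq₂ : QuadraticCoordinates.im (quadraticAdeleEquiv F E c hcδ hδ).toAddEquiv (w : AdeleRing (𝓞 E) E) = q₂)
    (x₁ x₂ y₁ y₂ : Fin n → AdeleRing (𝓞 F) F) :
    ((jS ⟨M * glDiagonal 2 (AdeleRing (𝓞 E) E) ![u, w] * M⁻¹, hA⟩ :
        symplecticGroup (polar (Matrix.toLinearMap₂' (AdeleRing (𝓞 F) F)
          (Matrix.fromBlocks (adelicGram F e TV TW) 0 0 (-adelicGram F e TV TW))))) :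
        ((Fin n ⊕ Fin n → AdeleRing (𝓞 F) F) × (Fin n ⊕ Fin n → AdeleRing (𝓞 F) F)) ≃ₗ[AdeleRing (𝓞 F) F]
          ((Fin n ⊕ Fin n → AdeleRing (𝓞 F) F) × (Fin n ⊕ Fin n → AdeleRing (𝓞 F) F))) (Sum.elim x₁ x₂, Sum.elim y₁ y₂) =
      (Sum.elim
          (⅟(2 : AdeleRing (𝓞 F) F) • ((p₁ • (x₁ + x₂) + algebraMap F (AdeleRing (𝓞 F) F) d • (q₁ • (y₁ + y₂))) +
              (p₂ • (x₁ - x₂) + algebraMap F (AdeleRing (𝓞 F) F) d • (q₂ • (y₁ - y₂)))))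
          (⅟(2 : AdeleRing (𝓞 F) F) • ((p₁ • (x₁ + x₂) + algebraMap F (AdeleRing (𝓞 F) F) d • (q₁ • (y₁ + y₂))) -
              (p₂ • (x₁ - x₂) + algebraMap F (AdeleRing (𝓞 F) F) d • (q₂ • (y₁ - y₂))))),
        Sum.elim
          (⅟(2 : AdeleRing (𝓞 F) F) • ((q₁ • (x₁ + x₂) + p₁ • (y₁ + y₂)) + (q₂ • (x₁ - x₂) + p₂ • (y₁ - y₂))))
          (⅟(2 : AdeleRing (𝓞 F) F) • ((q₁ • (x₁ + x₂) + p₁ • (y₁ + y₂)) - (q₂ • (x₁ - x₂) + p₂ • (y₁ - y₂))))) := by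
  have h := hjS ⟨M * glDiagonal 2 (AdeleRing (𝓞 E) E) ![u, w] * M⁻¹, hA⟩
    (reindexW (AdeleRing (𝓞 F) F) (finSumFinEquiv : Fin n ⊕ Fin n ≃ Fin (n + n)) (Sum.elim x₁ x₂, Sum.elim y₁ y₂))
  rw [coe_spReindex_apply, LinearEquiv.symm_apply_apply,
    toSp_adelicInr_cayley_conj_glDiagonal_apply F E c hcδ hδ hd N e TW hV hW2 hTW hM u w hA p₁ q₁ p₂ q₂ hp₁ hq₁ hp₂ hq₂
      x₁ x₂ y₁ y₂] at h
  exact (reindexW (AdeleRing (𝓞 F) F) (finSumFinEquiv : Fin n ⊕ Fin n ≃ Fin (n + n))).injective h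

/-- **THE TORUS GROUP LETTER (hLD-grp).**  For `t ∈ 𝔸_E^×` with `t⁻¹ = p₁ + q₁δ`, `c̄t = p₂ + q₂δ`, and ANY GL-element `Mt` with matrix
`reindex (p₂•1 | q₂•𝕋 ; (d q₂)•𝕋⁻¹ | p₂•1)`: the Levi element `d(t) = M·diag(t,(c̄t)⁻¹)·M⁻¹ ∈ U_D` has a lift `q ∈ Mp` over `j d(t)` with
`ω q = twistLM Mt` — a PURE TWIST (Weil's `d₀(α)`; no chirp, no phase).  Binders `u₀ hu₀ jS hjS j hj M hM` are those of
★ `exists_borelBound_frame` verbatim. [cite: Weil1964, Chap. I n° 13 p. 160] [cite: Weil1965, n° 46 p. 66] [cite: Li1992, p. 181] -/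
theorem exists_lift_torus [IsGalois F E] (h2 : ∀ σ : E ≃ₐ[F] E, σ = 1 ∨ σ = c) (hTW : TW 0 0 ≠ 0)
    (hTs : (adelicGram F e TV TW).IsSymm)
    -- the frame chirp as an element of `Mp` (★ `exists_frameUnipPair`)
    (u₀ : adelicMpCont F (Fin (n + n)) (doubledGramFin F (adelicGram F e TV TW)))
    (hu₀ : ∀ Ψ : piSchwartzBruhat F (Fin (n + n)),
      ((adelicMpCont.omega F (Fin (n + n)) (doubledGramFin F (adelicGram F e TV TW)) u₀ Ψ : piSchwartzBruhat F (Fin (n + n))) :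
          (Fin (n + n) → AdeleRing (𝓞 F) F) → ℂ) =
        chirp F (ratMatrix F (frameHalfRat F)) (Ψ : (Fin (n + n) → AdeleRing (𝓞 F) F) → ℂ))
    -- the `W`-side hom into the sum model (★ `exists_sumModelHom`, first conjunct)
    (jS : ↥(UnitaryGroup.adelic F E c (1 + 1)
        ((Matrix.reindex finSumFinEquiv finSumFinEquiv (Matrix.fromBlocks TW 0 0 (-TW))).map (algebraMap F E))) →*
      ↥(symplecticGroup (polar (Matrix.toLinearMap₂' (AdeleRing (𝓞 F) F)
        (Matrix.fromBlocks (adelicGram F e TV TW) 0 0 (-adelicGram F e TV TW))))))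
    (hjS : ∀ (A : ↥(UnitaryGroup.adelic F E c (1 + 1)
        ((Matrix.reindex finSumFinEquiv finSumFinEquiv (Matrix.fromBlocks TW 0 0 (-TW))).map (algebraMap F E))))
        (v : (Fin (n + n) → AdeleRing (𝓞 F) F) × (Fin (n + n) → AdeleRing (𝓞 F) F)),
      ((spReindex (finSumFinEquiv : Fin n ⊕ Fin n ≃ Fin (n + n))
          (Matrix.fromBlocks (adelicGram F e TV TW) 0 0 (-adelicGram F e TV TW)) (jS A) :
          symplecticGroup (polar (Matrix.toLinearMap₂' (AdeleRing (𝓞 F) F)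
            (Matrix.reindex finSumFinEquiv finSumFinEquiv
              (Matrix.fromBlocks (adelicGram F e TV TW) 0 0 (-adelicGram F e TV TW)))))) :
        ((Fin (n + n) → AdeleRing (𝓞 F) F) × (Fin (n + n) → AdeleRing (𝓞 F) F)) ≃ₗ[AdeleRing (𝓞 F) F]
          ((Fin (n + n) → AdeleRing (𝓞 F) F) × (Fin (n + n) → AdeleRing (𝓞 F) F))) v =
      ((toSp F E c N (1 + 1)
          (((Equiv.prodCongr (Equiv.refl (Fin N)) finSumFinEquiv.symm).trans (Equiv.prodSumDistrib (Fin N) (Fin 1) (Fin 1))).trans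
            ((Equiv.sumCongr e e).trans finSumFinEquiv))
          (TV.map (algebraMap F E)) ((Matrix.reindex finSumFinEquiv finSumFinEquiv (Matrix.fromBlocks TW 0 0 (-TW))).map (algebraMap F E))
          hcδ hδ hd hV hW2 rfl rfl
          (adelicInr F E c N (1 + 1) (TV.map (algebraMap F E))
            ((Matrix.reindex finSumFinEquiv finSumFinEquiv (Matrix.fromBlocks TW 0 0 (-TW))).map (algebraMap F E)) A) :
          symplecticGroup (polar (adelicForm F (Fin (n + n))
            (adelicGram F
              (((Equiv.prodCongr (Equiv.refl (Fin N)) finSumFinEquiv.symm).trans (Equiv.prodSumDistrib (Fin N) (Fin 1) (Fin 1))).trans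
                ((Equiv.sumCongr e e).trans finSumFinEquiv)) TV
              (Matrix.reindex finSumFinEquiv finSumFinEquiv (Matrix.fromBlocks TW 0 0 (-TW))))))) :
        ((Fin (n + n) → AdeleRing (𝓞 F) F) × (Fin (n + n) → AdeleRing (𝓞 F) F)) ≃ₗ[AdeleRing (𝓞 F) F]
          ((Fin (n + n) → AdeleRing (𝓞 F) F) × (Fin (n + n) → AdeleRing (𝓞 F) F))) v)
    -- THE HOM OF RECORD `j = conj(π u₀ · π(doublingDeltaLift)) ∘ spReindex ∘ jS`
    (j : ↥(UnitaryGroup.adelic F E c (1 + 1)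
        ((Matrix.reindex finSumFinEquiv finSumFinEquiv (Matrix.fromBlocks TW 0 0 (-TW))).map (algebraMap F E))) →*
      ↥(symplecticGroup (polar (adelicForm F (Fin (n + n)) (doubledGramFin F (adelicGram F e TV TW))))))
    (hj : j = (MulAut.conj (adelicMpCont.proj F (Fin (n + n)) (doubledGramFin F (adelicGram F e TV TW)) u₀ *
        adelicMpCont.proj F (Fin (n + n)) (doubledGramFin F (adelicGram F e TV TW))
          (doublingDeltaLift F (adelicGram F e TV TW) (isUnit_det_adelicGram F e hVd hWd)))).toMonoidHom.comp
      ((spReindex (finSumFinEquiv : Fin n ⊕ Fin n ≃ Fin (n + n))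
        (Matrix.fromBlocks (adelicGram F e TV TW) 0 0 (-adelicGram F e TV TW))).comp jS))
    -- the Cayley matrix
    {M : GL (Fin 2) (AdeleRing (𝓞 E) E)}
    (hM : (M : Matrix (Fin 2) (Fin 2) (AdeleRing (𝓞 E) E)) =
      !![1, algebraMap E (AdeleRing (𝓞 E) E) (algebraMap F E (2 * TW 0 0)⁻¹);
        1, -algebraMap E (AdeleRing (𝓞 E) E) (algebraMap F E (2 * TW 0 0)⁻¹)])
    -- the torus element and the quadratic coordinates of `U = t⁻¹`, `V = c̄t`
    (t : (AdeleRing (𝓞 E) E)ˣ) (p₁ q₁ p₂ q₂ : AdeleRing (𝓞 F) F)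
    (hp₁ : QuadraticCoordinates.re (quadraticAdeleEquiv F E c hcδ hδ).toAddEquiv (((t⁻¹ : (AdeleRing (𝓞 E) E)ˣ)) : AdeleRing (𝓞 E) E) = p₁)
    (hq₁ : QuadraticCoordinates.im (quadraticAdeleEquiv F E c hcδ hδ).toAddEquiv (((t⁻¹ : (AdeleRing (𝓞 E) E)ˣ)) : AdeleRing (𝓞 E) E) = q₁)
    (hp₂ : QuadraticCoordinates.re (quadraticAdeleEquiv F E c hcδ hδ).toAddEquiv (UnitaryGroup.conjAdele F E c (t : AdeleRing (𝓞 E) E)) = p₂)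
    (hq₂ : QuadraticCoordinates.im (quadraticAdeleEquiv F E c hcδ hδ).toAddEquiv (UnitaryGroup.conjAdele F E c (t : AdeleRing (𝓞 E) E)) = q₂)
    -- the twist matrix (pinned)
    (Mt : GL (Fin (n + n)) (AdeleRing (𝓞 F) F))
    (hMt : (Mt : Matrix (Fin (n + n)) (Fin (n + n)) (AdeleRing (𝓞 F) F)) =
      Matrix.reindex finSumFinEquiv finSumFinEquiv
        (Matrix.fromBlocks (p₂ • (1 : Matrix (Fin n) (Fin n) (AdeleRing (𝓞 F) F))) (q₂ • adelicGram F e TV TW)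
          ((algebraMap F (AdeleRing (𝓞 F) F) d * q₂) • (adelicGram F e TV TW)⁻¹)
          (p₂ • (1 : Matrix (Fin n) (Fin n) (AdeleRing (𝓞 F) F))))) :
    ∃ q : adelicMpCont F (Fin (n + n)) (doubledGramFin F (adelicGram F e TV TW)),
      adelicMpCont.proj F (Fin (n + n)) (doubledGramFin F (adelicGram F e TV TW)) q =
        j ⟨M * glDiagonal 2 (AdeleRing (𝓞 E) E)
            ![t, (Units.map (UnitaryGroup.conjAdele F E c : AdeleRing (𝓞 E) E →* AdeleRing (𝓞 E) E) t)⁻¹] * M⁻¹,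
          cayley_conj_diag_mem_adelic F E c TW h2 hTW hM t⟩ ∧
      ∀ Ψ : piSchwartzBruhat F (Fin (n + n)),
        adelicMpCont.omega F (Fin (n + n)) (doubledGramFin F (adelicGram F e TV TW)) q Ψ = twistLM F Mt Ψ := by
  have hq := isQuadraticCoordinates_adele E c hcδ hδ hd
  have hττ := conjAdele_conjAdele F E c h2
  -- the element, its inverse, and their sum-model actions
  have hA := cayley_conj_diag_mem_adelic F E c TW h2 hTW hM t
  have hAinv : (⟨M * glDiagonal 2 (AdeleRing (𝓞 E) E) ![t, (Units.map (UnitaryGroup.conjAdele F E c : AdeleRing (𝓞 E) E →* AdeleRing (𝓞 E) E) t)⁻¹] * M⁻¹, hA⟩ :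
        ↥(UnitaryGroup.adelic F E c (1 + 1)
          ((Matrix.reindex finSumFinEquiv finSumFinEquiv (Matrix.fromBlocks TW 0 0 (-TW))).map (algebraMap F E))))⁻¹ =
      ⟨M * glDiagonal 2 (AdeleRing (𝓞 E) E) ![t⁻¹, (Units.map (UnitaryGroup.conjAdele F E c : AdeleRing (𝓞 E) E →* AdeleRing (𝓞 E) E) t⁻¹)⁻¹] * M⁻¹,
        cayley_conj_diag_mem_adelic F E c TW h2 hTW hM t⁻¹⟩ :=
    Subtype.ext (cayley_conj_diag_inv F E c M t)
  -- `w = (τ t⁻¹)⁻¹ = τ t` for the inverse element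
  have hw : (((Units.map (UnitaryGroup.conjAdele F E c : AdeleRing (𝓞 E) E →* AdeleRing (𝓞 E) E) t⁻¹)⁻¹ : (AdeleRing (𝓞 E) E)ˣ) : AdeleRing (𝓞 E) E) =
      UnitaryGroup.conjAdele F E c (t : AdeleRing (𝓞 E) E) := by
    rw [map_inv, inv_inv]; rfl
  have hp₂' : QuadraticCoordinates.re (quadraticAdeleEquiv F E c hcδ hδ).toAddEquiv
      ((((Units.map (UnitaryGroup.conjAdele F E c : AdeleRing (𝓞 E) E →* AdeleRing (𝓞 E) E) t⁻¹)⁻¹ : (AdeleRing (𝓞 E) E)ˣ) : AdeleRing (𝓞 E) E)) = p₂ := by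
    rw [hw]; exact hp₂
  have hq₂' : QuadraticCoordinates.im (quadraticAdeleEquiv F E c hcδ hδ).toAddEquiv
      ((((Units.map (UnitaryGroup.conjAdele F E c : AdeleRing (𝓞 E) E →* AdeleRing (𝓞 E) E) t⁻¹)⁻¹ : (AdeleRing (𝓞 E) E)ˣ) : AdeleRing (𝓞 E) E)) = q₂ := by
    rw [hw]; exact hq₂
  -- the action of `g⁻¹ = jS d(t⁻¹)` (scalars `U = t⁻¹` on `W^Δ`, `V = τ t` on `W^∇`)
  have hgv' : ∀ x₁ x₂ y₁ y₂ : Fin n → AdeleRing (𝓞 F) F,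
      ((jS ⟨M * glDiagonal 2 (AdeleRing (𝓞 E) E) ![t, (Units.map (UnitaryGroup.conjAdele F E c : AdeleRing (𝓞 E) E →* AdeleRing (𝓞 E) E) t)⁻¹] * M⁻¹, hA⟩ :
          symplecticGroup (polar (Matrix.toLinearMap₂' (AdeleRing (𝓞 F) F)
            (Matrix.fromBlocks (adelicGram F e TV TW) 0 0 (-adelicGram F e TV TW))))) :
          ((Fin n ⊕ Fin n → AdeleRing (𝓞 F) F) × (Fin n ⊕ Fin n → AdeleRing (𝓞 F) F)) ≃ₗ[AdeleRing (𝓞 F) F]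
            ((Fin n ⊕ Fin n → AdeleRing (𝓞 F) F) × (Fin n ⊕ Fin n → AdeleRing (𝓞 F) F))).symm (Sum.elim x₁ x₂, Sum.elim y₁ y₂) =
        (Sum.elim ((⅟(2 : AdeleRing (𝓞 F) F)) • ((p₁ • (x₁ + x₂) + (algebraMap F (AdeleRing (𝓞 F) F) d * q₁) • (y₁ + y₂)) +
              (p₂ • (x₁ - x₂) + (algebraMap F (AdeleRing (𝓞 F) F) d * q₂) • (y₁ - y₂))))
            ((⅟(2 : AdeleRing (𝓞 F) F)) • ((p₁ • (x₁ + x₂) + (algebraMap F (AdeleRing (𝓞 F) F) d * q₁) • (y₁ + y₂)) -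
              (p₂ • (x₁ - x₂) + (algebraMap F (AdeleRing (𝓞 F) F) d * q₂) • (y₁ - y₂)))),
          Sum.elim ((⅟(2 : AdeleRing (𝓞 F) F)) • ((q₁ • (x₁ + x₂) + p₁ • (y₁ + y₂)) + (q₂ • (x₁ - x₂) + p₂ • (y₁ - y₂))))
            ((⅟(2 : AdeleRing (𝓞 F) F)) • ((q₁ • (x₁ + x₂) + p₁ • (y₁ + y₂)) - (q₂ • (x₁ - x₂) + p₂ • (y₁ - y₂))))) := by
    intro x₁ x₂ y₁ y₂
    have hsymm : ((jS ⟨M * glDiagonal 2 (AdeleRing (𝓞 E) E) ![t, (Units.map (UnitaryGroup.conjAdele F E c : AdeleRing (𝓞 E) E →* AdeleRing (𝓞 E) E) t)⁻¹] * M⁻¹, hA⟩ :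
          symplecticGroup (polar (Matrix.toLinearMap₂' (AdeleRing (𝓞 F) F)
            (Matrix.fromBlocks (adelicGram F e TV TW) 0 0 (-adelicGram F e TV TW))))) :
          ((Fin n ⊕ Fin n → AdeleRing (𝓞 F) F) × (Fin n ⊕ Fin n → AdeleRing (𝓞 F) F)) ≃ₗ[AdeleRing (𝓞 F) F]
            ((Fin n ⊕ Fin n → AdeleRing (𝓞 F) F) × (Fin n ⊕ Fin n → AdeleRing (𝓞 F) F))).symm =
        ((jS ⟨M * glDiagonal 2 (AdeleRing (𝓞 E) E) ![t⁻¹, (Units.map (UnitaryGroup.conjAdele F E c : AdeleRing (𝓞 E) E →* AdeleRing (𝓞 E) E) t⁻¹)⁻¹] * M⁻¹,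
            cayley_conj_diag_mem_adelic F E c TW h2 hTW hM t⁻¹⟩ :
          symplecticGroup (polar (Matrix.toLinearMap₂' (AdeleRing (𝓞 F) F)
            (Matrix.fromBlocks (adelicGram F e TV TW) 0 0 (-adelicGram F e TV TW))))) :
          ((Fin n ⊕ Fin n → AdeleRing (𝓞 F) F) × (Fin n ⊕ Fin n → AdeleRing (𝓞 F) F)) ≃ₗ[AdeleRing (𝓞 F) F]
            ((Fin n ⊕ Fin n → AdeleRing (𝓞 F) F) × (Fin n ⊕ Fin n → AdeleRing (𝓞 F) F))) := by
      rw [← hAinv, map_inv]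
      rfl
    rw [hsymm, sumModel_apply_sumElim_levi F E c hcδ hδ hd N e TW hV hW2 hTW jS hjS hM t⁻¹ _
      (cayley_conj_diag_mem_adelic F E c TW h2 hTW hM t⁻¹) p₁ q₁ p₂ q₂ hp₁ hq₁ hp₂' hq₂' x₁ x₂ y₁ y₂]
    simp only [mul_smul]
  -- the action of `g` itself (scalars `t`, `(τ t)⁻¹`): only its DIAGONAL-preserving property is needed
  have hgv := fun x₁ x₂ y₁ y₂ => sumModel_apply_sumElim_levi F E c hcδ hδ hd N e TW hV hW2 hTW jS hjS hM t _ hA _ _ _ _ rfl rfl rfl rfl x₁ x₂ y₁ y₂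
  -- `g ∈ Stab(W^Δ)`
  have hg : jS ⟨M * glDiagonal 2 (AdeleRing (𝓞 E) E) ![t, (Units.map (UnitaryGroup.conjAdele F E c : AdeleRing (𝓞 E) E →* AdeleRing (𝓞 E) E) t)⁻¹] * M⁻¹, hA⟩ ∈
      stabDiag (adelicGram F e TV TW) := by
    refine mem_stabDiag_of_apply_diag (adelicGram F e TV TW) _ (fun x y => ?_) (fun x y => ?_)
    · rw [hgv]
      simp only [sub_self, smul_zero, add_zero, sub_zero]
      exact isDiag_diag _ _
    · rw [hgv']
      simp only [sub_self, smul_zero, add_zero, sub_zero]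
      exact isDiag_diag _ _
  -- `U · τV = 1`: the two scalar identities
  have hUV : (((t⁻¹ : (AdeleRing (𝓞 E) E)ˣ)) : AdeleRing (𝓞 E) E) * UnitaryGroup.conjAdele F E c (UnitaryGroup.conjAdele F E c (t : AdeleRing (𝓞 E) E)) = 1 := by
    rw [hττ]; exact t.inv_mul
  have hτf : ∀ a, UnitaryGroup.conjAdele F E c (AdeleRing.baseChange F E a) = AdeleRing.baseChange F E a := fun a => by
    rw [UnitaryGroup.conjAdele_apply, AdeleRing.smul_baseChange]
  have hτδ : UnitaryGroup.conjAdele F E c (algebraMap E (AdeleRing (𝓞 E) E) δ) = -algebraMap E (AdeleRing (𝓞 E) E) δ :=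
    conjAdele_algebraMap_eq_neg F E c δ hcδ
  have hUV₁ : p₁ * p₂ - algebraMap F (AdeleRing (𝓞 F) F) d * q₁ * q₂ = 1 := by
    have h := congrArg (QuadraticCoordinates.re (quadraticAdeleEquiv F E c hcδ hδ).toAddEquiv) hUV
    rw [hq.re_mul, hq.re_conj hτf hτδ, hq.im_conj hτf hτδ, hp₁, hq₁, hp₂, hq₂, hq.re_one] at h
    linear_combination h
  have hUV₂ : p₁ * q₂ = q₁ * p₂ := by
    have h := congrArg (QuadraticCoordinates.im (quadraticAdeleEquiv F E c hcδ hδ).toAddEquiv) hUV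
    rw [hq.im_mul, hq.re_conj hτf hτδ, hq.im_conj hτf hτδ, hp₁, hq₁, hp₂, hq₂, hq.im_one] at h
    linear_combination -h
  -- the parabolic element and the lift
  have hP := coe_stabDiagParabolicFin F (adelicGram F e TV TW) (isUnit_det_adelicGram F e hVd hWd) ⟨_, hg⟩
  refine ⟨u₀ * adelicSiegelLiftCont F (doubledGramFin F (adelicGram F e TV TW))
      (isUnit_det_doubledGramFin F (adelicGram F e TV TW) (isUnit_det_adelicGram F e hVd hWd))
      (stabDiagParabolicFin F (adelicGram F e TV TW) (isUnit_det_adelicGram F e hVd hWd) ⟨_, hg⟩) * u₀⁻¹, ?_, fun Ψ => ?_⟩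
  · rw [hj]
    exact proj_frameLift_eq F (adelicGram F e TV TW) (isUnit_det_adelicGram F e hVd hWd) u₀ _ hg
  · exact omega_conj_adelicSiegelLiftCont_of_torusShape F (adelicGram F e TV TW) (isUnit_det_adelicGram F e hVd hWd)
      (g := jS ⟨M * glDiagonal 2 (AdeleRing (𝓞 E) E) ![t, (Units.map (UnitaryGroup.conjAdele F E c : AdeleRing (𝓞 E) E →* AdeleRing (𝓞 E) E) t)⁻¹] * M⁻¹, hA⟩)
      (P := stabDiagParabolicFin F (adelicGram F e TV TW) (isUnit_det_adelicGram F e hVd hWd) ⟨_, hg⟩)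
      (u₀ := u₀) (hu₀ := hu₀) (hP := hP) (hD' := hgv') (hTs := hTs) (hUV₁ := hUV₁) (hUV₂ := hUV₂) (M := Mt) (hM := hMt) Ψ

end Summit.HodgeConjecture.HodgeConjecture.Cruxes.H413.E2SWBorelBoundTorus

end
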